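import Summits.CriticalPhenomena.Ising3D.TaylorTableExpr
import Summits.CriticalPhenomena.Ising3D.TaylorIdentityQPoly
import Mathlib.Analysis.SpecialFunctions.Pow.Real
import Mathlib.Tactic.Linarith
import Mathlib.Tactic.Positivity
import Mathlib.Tactic.Ring
import HarnessLib

/-!
# The TABLE layer of a derivative certificate, II: the identity obligation (I) from a kd-tree check
(cell `pub-ising3x`, seat boot-1 gen 6; gate (g2) — first field of the rational table theorem, end to end)

HONEST FRAMING: lottery ticket; floor = tightest certified 3D Ising CFT bounds; no exact-solution
claim without a proof.

Field (I) `identity_pos` of `TaylorTermwiseObligations` / `TaylorConeObligations` for the functional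
`taylorCrossing ½ ½ S w` with rational weights `w i ab = c i ab` on a rational box
`Q = [σlo, σhi] × [εlo, εhi]`. By `identityTerm_taylorCrossing_half_pos_iff` it is the positivity of
`Î₁(Δσ) + κ² Î₂(Δε) + κ (Î₄ + Î₅)((Δσ+Δε)/2)` with `κ = (½)^{Δε-Δσ}` and polynomial q-sums `Î`. The ONE
transcendental quantity `κ` becomes an ENCLOSURE VARIABLE: `(½)^t` is antitone, so on the box
`κ ∈ [(½)^{r₂}, (½)^{r₁}]` for rationals `r₁ ≤ εlo - σhi`, `εhi - σlo ≤ r₂`, and rational bounds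
`klo ≤ (½)^{r₂}`, `(½)^{r₁} ≤ khi` are DECIDABLE (`klo^{den r₂} ≤ (½)^{num r₂}` etc.,
`half_rpow_ge_of_pow_le` / `half_rpow_le_of_le_pow`). The obligation is then the `BoxBoundClaim`
"`-identityExpr ≤ b < 0` on `[σlo,σhi] × [εlo,εhi] × [klo,khi]`", discharged by any accepted kd-tree of
working precisions (`identity_pos_of_kdCheck`) — kernel-replayable by `decide`, and the normative reader
check for (I). This is the pattern ("POLYBOX") of the whole table: the remaining fields differ only in the
polynomial and in which enclosure variables enter (block coefficients over Δ-cells; `(½)^{linear}`).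
Elementary.
-/

namespace Summit.CriticalPhenomena.Ising3D

open Finset Set
open Literature.MathematicalPhysics.QuantumFieldTheory.ConformalBootstrap3D
open Literature.Analysis.ValidatedNumerics

/-! ### Rational enclosure of `(½)^t` -/

/-- `(½)^r` at a rational exponent, raised to the denominator: `((½)^r)^{den r} = (½)^{num r}`. [folklore] -/
theorem half_rpow_ratCast_pow_den (r : ℚ) :
    ((1 / 2 : ℝ) ^ (r : ℝ)) ^ r.den = (1 / 2 : ℝ) ^ (r.num : ℤ) := by
  have h0 : (0 : ℝ) ≤ 1 / 2 := by norm_num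
  rw [← Real.rpow_mul_natCast h0, ← Real.rpow_intCast]
  congr 1
  have : ((r * r.den : ℚ) : ℝ) = ((r.num : ℚ) : ℝ) := by rw [Rat.mul_den_eq_num]
  push_cast at this
  exact this

/-- **Lower rational bound of `(½)^r`** from a decidable check: `klo^{den r} ≤ (½)^{num r}`
gives `klo ≤ (½)^r` (no sign condition on `klo` is needed). [folklore] -/
theorem half_rpow_ge_of_pow_le {r klo : ℚ}
    (h : klo ^ r.den ≤ (1 / 2 : ℚ) ^ (r.num : ℤ)) : (klo : ℝ) ≤ (1 / 2 : ℝ) ^ (r : ℝ) := by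
  by_contra hlt
  rw [not_le] at hlt
  have h0 : (0 : ℝ) < 1 / 2 := by norm_num
  have hpos : 0 ≤ (1 / 2 : ℝ) ^ (r : ℝ) := (Real.rpow_pos_of_pos h0 _).le
  have h1 : ((1 / 2 : ℝ) ^ (r : ℝ)) ^ r.den < (klo : ℝ) ^ r.den :=
    pow_lt_pow_left₀ hlt hpos r.den_ne_zero
  rw [half_rpow_ratCast_pow_den] at h1
  have h2 : ((klo ^ r.den : ℚ) : ℝ) ≤ (((1 / 2 : ℚ) ^ (r.num : ℤ) : ℚ) : ℝ) := by exact_mod_cast h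
  push_cast at h2
  linarith

/-- **Upper rational bound of `(½)^r`** from a decidable check: `(½)^{num r} ≤ khi^{den r}` and `0 < khi`
give `(½)^r ≤ khi`. [folklore] -/
theorem half_rpow_le_of_le_pow {r khi : ℚ} (hkhi : 0 < khi)
    (h : (1 / 2 : ℚ) ^ (r.num : ℤ) ≤ khi ^ r.den) : (1 / 2 : ℝ) ^ (r : ℝ) ≤ (khi : ℝ) := by
  by_contra hlt
  rw [not_le] at hlt
  have hk0 : (0 : ℝ) ≤ (khi : ℝ) := by exact_mod_cast hkhi.le
  have h1 : (khi : ℝ) ^ r.den < ((1 / 2 : ℝ) ^ (r : ℝ)) ^ r.den :=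
    pow_lt_pow_left₀ hlt hk0 r.den_ne_zero
  rw [half_rpow_ratCast_pow_den] at h1
  have h2 : (((1 / 2 : ℚ) ^ (r.num : ℤ) : ℚ) : ℝ) ≤ ((khi ^ r.den : ℚ) : ℝ) := by exact_mod_cast h
  push_cast at h2
  linarith

/-- **Enclosure of `κ = (½)^{Δε-Δσ}` over a box**: if `r₁ ≤ Δε - Δσ ≤ r₂` and the two decidable bounds
hold, then `klo ≤ (½)^{Δε-Δσ} ≤ khi`. [folklore] -/
theorem half_rpow_mem_of_checks {r₁ r₂ klo khi : ℚ} (hkhi : 0 < khi)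
    (h₁ : klo ^ r₂.den ≤ (1 / 2 : ℚ) ^ (r₂.num : ℤ)) (h₂ : (1 / 2 : ℚ) ^ (r₁.num : ℤ) ≤ khi ^ r₁.den)
    {t : ℝ} (ht₁ : (r₁ : ℝ) ≤ t) (ht₂ : t ≤ (r₂ : ℝ)) :
    (klo : ℝ) ≤ (1 / 2 : ℝ) ^ t ∧ (1 / 2 : ℝ) ^ t ≤ (khi : ℝ) := by
  have h0 : (0 : ℝ) < 1 / 2 := by norm_num
  have h1 : (1 / 2 : ℝ) ≤ 1 := by norm_num
  exact ⟨(half_rpow_ge_of_pow_le h₁).trans (Real.rpow_le_rpow_of_exponent_ge h0 h1 ht₂),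
    (Real.rpow_le_rpow_of_exponent_ge h0 h1 ht₁).trans (half_rpow_le_of_le_pow hkhi h₂)⟩

/-! ### The identity polynomial and the table theorem for (I) -/

/-- The identity check polynomial `Î₁(x₀) + x₂² Î₂(x₁) + x₂ (Î₄ + Î₅)((x₀+x₁)/2)` in the variables
`x₀ = Δσ`, `x₁ = Δε`, `x₂ = κ`, for rational weights `c` on the index list `L`. [folklore] -/
def identityExpr (c : Fin 5 → ℕ × ℕ → ℚ) (L : List (ℕ × ℕ)) : ArithExpr :=
  .add (.add (qSumExpr (c 0) L (.var 0) (-1) (.const 0) 0)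
      (.mul (.mul (.var 2) (.var 2)) (qSumExpr (c 1) L (.var 1) (-1) (.const 0) 0)))
    (.mul (.var 2)
      (.add (qSumExpr (c 3) L (.mul (.add (.var 0) (.var 1)) (.const (1 / 2))) (-1) (.const 0) 0)
        (qSumExpr (c 4) L (.mul (.add (.var 0) (.var 1)) (.const (1 / 2))) 1 (.const 0) 0)))

/-- Evaluation of `identityExpr` at `(Δσ, Δε, κ, …)`. [folklore] -/
theorem eval_identityExpr (c : Fin 5 → ℕ × ℕ → ℚ) {L : List (ℕ × ℕ)} (hL : L.Nodup) (x : ℕ → ℝ) :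
    (identityExpr c L).eval x =
      qSum (fun ab => (c 0 ab : ℝ)) L.toFinset (x 0) (-1) 0 0 +
        (x 2) ^ 2 * qSum (fun ab => (c 1 ab : ℝ)) L.toFinset (x 1) (-1) 0 0 +
        x 2 * (qSum (fun ab => (c 3 ab : ℝ)) L.toFinset ((x 0 + x 1) / 2) (-1) 0 0 +
          qSum (fun ab => (c 4 ab : ℝ)) L.toFinset ((x 0 + x 1) / 2) 1 0 0) := by
  simp only [identityExpr, ArithExpr.eval_add, ArithExpr.eval_mul, ArithExpr.eval_var,
    ArithExpr.eval_const, eval_qSumExpr x _ hL]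
  push_cast
  ring_nf

/-- The point `(Δσ, Δε, κ, 0, 0, …)` fed to the expression. [folklore] -/
noncomputable def identityPoint (Δσ Δε : ℝ) : ℕ → ℝ
  | 0 => Δσ
  | 1 => Δε
  | 2 => (1 / 2 : ℝ) ^ (Δε - Δσ)
  | _ => 0

/-- **TABLE THEOREM, field (I).** For rational weights `c` on a duplicate-free index list `L`, a box
`[σlo, σhi] × [εlo, εhi]`, rational `κ`-enclosure data `(r₁, r₂, klo, khi)` (`khi > 0`) passing the decidable checks,
and an accepted kd-tree certificate `t` of `-identityExpr ≤ b` with `b < 0` on the box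
`[σlo, σhi] × [εlo, εhi] × [klo, khi]`: the identity term of `taylorCrossing ½ ½ L.toFinset c` is
positive at every point of the box. [cite: KosPolandSimmonsduffin2014, §3.2 eq. (3.15)] -/
theorem identity_pos_of_kdCheck (c : Fin 5 → ℕ × ℕ → ℚ) {L : List (ℕ × ℕ)} (hL : L.Nodup)
    {σlo σhi εlo εhi r₁ r₂ klo khi b : ℚ} (hkhi : 0 < khi)
    (hr₁ : r₁ ≤ εlo - σhi) (hr₂ : εhi - σlo ≤ r₂)
    (h₁ : klo ^ r₂.den ≤ (1 / 2 : ℚ) ^ (r₂.num : ℤ)) (h₂ : (1 / 2 : ℚ) ^ (r₁.num : ℤ) ≤ khi ^ r₁.den)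
    {t : KdCert ℕ}
    (ht : t.check (exprLeOn (.neg (identityExpr c L)) b) [(σlo, σhi), (εlo, εhi), (klo, khi)] = true)
    (hb : b < 0) :
    ∀ p ∈ Icc (σlo : ℝ) σhi ×ˢ Icc (εlo : ℝ) εhi,
      0 < (taylorCrossing (1 / 2) (1 / 2) L.toFinset (fun i ab => (c i ab : ℝ))).identityTerm p.1 p.2 := by
  intro p hp
  obtain ⟨⟨hσ1, hσ2⟩, ⟨hε1, hε2⟩⟩ := hp
  have hr₁' : (r₁ : ℝ) ≤ (εlo : ℝ) - (σhi : ℝ) := by exact_mod_cast hr₁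
  have hr₂' : (εhi : ℝ) - (σlo : ℝ) ≤ (r₂ : ℝ) := by exact_mod_cast hr₂
  have hκ := half_rpow_mem_of_checks hkhi h₁ h₂ (t := p.2 - p.1) (by linarith) (by linarith)
  have hmem : Box.mem [(σlo, σhi), (εlo, εhi), (klo, khi)] (identityPoint p.1 p.2) := by
    intro i
    match i with
    | 0 => exact ⟨hσ1, hσ2⟩
    | 1 => exact ⟨hε1, hε2⟩
    | 2 => exact hκ
    | n + 3 => simp [Box.ivl, identityPoint]
  have hpos := pos_of_kdCheck_neg ht hb _ hmem
  rw [eval_identityExpr c hL] at hpos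
  rw [identityTerm_taylorCrossing_half_pos_iff]
  simpa [identityPoint] using hpos

/-! ### Kernel smoke test

The whole pipeline computes inside the kernel: for the toy functional with the single weight
`c₀(1,0) = -1` (so that the identity polynomial is `4Δσ`), on the box `Δσ ∈ [0.518, 0.5185]`,
`Δε ∈ [1.41, 1.42]`, with `κ`-data `r₁ = 89/100`, `r₂ = 91/100`, `klo = 1/2`, `khi = 3/5`, a one-leaf
certificate at precision `20` proves `-identity ≤ -1`; all side checks are `decide`d. -/

/-- Toy weights: `c₀(1,0) = -1`, everything else `0`. [folklore] -/
def toyIdentityWeights : Fin 5 → ℕ × ℕ → ℚ := fun i ab => if i = 0 ∧ ab = (1, 0) then -1 else 0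

/-- Kernel smoke test of `identity_pos_of_kdCheck` (toy functional, one leaf). [folklore] -/
example : ∀ p ∈ Icc ((518 / 1000 : ℚ) : ℝ) (5185 / 10000 : ℚ) ×ˢ Icc ((141 / 100 : ℚ) : ℝ) (142 / 100 : ℚ),
    0 < (taylorCrossing (1 / 2) (1 / 2) [(1, 0)].toFinset
      (fun i ab => (toyIdentityWeights i ab : ℝ))).identityTerm p.1 p.2 :=
  identity_pos_of_kdCheck toyIdentityWeights (L := [(1, 0)]) (by decide)
    (r₁ := 89 / 100) (r₂ := 91 / 100) (klo := 1 / 2) (khi := 3 / 5) (b := -1) (by norm_num)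
    (by norm_num) (by norm_num) (by decide +kernel) (by decide +kernel) (t := .leaf 20)
    (by decide +kernel) (by norm_num)

end Summit.CriticalPhenomena.Ising3D
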